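import Summits.Ventures.PercRepro.S1TriangleKernelSixLemmas

/-!
# PercRepro — THE TRIANGLE KERNEL AT NULLITY `6`, CASE B (`|U| = 11`, `r(U) = 5`) (p8, gen 24; a feeder for S4 —
the rows `≤ 36` of the `q = 7` window)

With `s₃ = 11` at nullity `6`, `m = 3` at the point `x` on the fewest triangles, `|U| = 11` and `r(U) = 5` for
`U = ⋃ triangles`: `Q = U ∖ St` has `4` points. Some `q ∈ U` lies off `cl(St)` (rank `≤ 4`); every triangle through such
a `q` has a second point off `cl(St)`, so `U ∖ cl(St)` has `≥ 4` points and equals `Q`. Then no triangle avoiding `x`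
has two star points (its third point would be in `cl(St)`), and the `6` star points off `x`, each on `≥ 2` triangles
avoiding `x`, give `≥ 12` distinct triangles avoiding `x`, against `8` (`false_of_ncard_sdiff_star_eq_four`).
Axioms: standard.
-/

open scoped Matroid

namespace PercRepro

namespace S1

open Set

variable {α : Type}

/-- **CASE B of the kernel at nullity `6`**: with the three triangles `Cᵢ, Cⱼ, C_k` through `x` (all of them), every point
of `U` on `≥ 3` triangles, `8` triangles avoiding `x`, `|U ∖ St| = 4` and `r(U) = 5`, a contradiction. -/
theorem false_of_ncard_sdiff_star_eq_four (M : Matroid α) [M.Finite]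
    (hC1 : ∀ L ⊆ M.E, M.eRk L = 2 → L.ncard ≤ 3)
    (hC2 : ∀ X ⊆ M.E, M.eRk X ≤ 3 → X.ncard ≤ 6) {x : α} (hx : M.IsNonloop x)
    {Ci Cj Ck : Set α} (hCi : Ci ∈ ThmN.trianglesThrough M x) (hCj : Cj ∈ ThmN.trianglesThrough M x)
    (hCk : Ck ∈ ThmN.trianglesThrough M x) (hij : Ci ≠ Cj) (hik : Ci ≠ Ck) (hjk : Cj ≠ Ck)
    (hmem3 : ∀ C, C ∈ ThmN.trianglesThrough M x → C = Ci ∨ C = Cj ∨ C = Ck)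
    (hmin3 : ∀ y ∈ ⋃₀ ThmN.triangles M, 3 ≤ (ThmN.trianglesThrough M y).ncard)
    (hS₂card : {C | M.IsCircuit C ∧ C.ncard = 3 ∧ x ∉ C}.ncard = 8)
    (hQ4 : ((⋃₀ ThmN.triangles M) \ ({x} ∪ (Ci ∪ Cj ∪ Ck))).ncard = 4)
    (hr5 : M.eRk (⋃₀ ThmN.triangles M) = 5) : False := by
  classical
  set S := ThmN.triangles M with hS
  have hSfin : S.Finite :=
    M.ground_finite.finite_subsets.subset (fun C hC => hC.1.subset_ground)
  have hUE : ⋃₀ S ⊆ M.E := by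
    intro z hz
    obtain ⟨C, hC, hzC⟩ := Set.mem_sUnion.1 hz
    exact hC.1.subset_ground hzC
  have hUfin : (⋃₀ S).Finite := M.ground_finite.subset hUE
  have hxU' : x ∈ ⋃₀ S := Set.mem_sUnion.2 ⟨Ci, ⟨hCi.1, hCi.2.1⟩, hCi.2.2⟩
  -- the star of `x`: `s = {C₁, C₂, C₃}`, `St` with `7` points and rank `≤ 4`
  set s : Finset (Set α) := {Ci, Cj, Ck} with hsdef
  have hs : ∀ C ∈ s, C ∈ ThmN.trianglesThrough M x := by
    intro C hC
    simp only [hsdef, Finset.mem_insert, Finset.mem_singleton] at hC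
    rcases hC with rfl | rfl | rfl
    · exact hCi
    · exact hCj
    · exact hCk
  have hscard : s.card = 3 := Finset.card_eq_three.2 ⟨Ci, Cj, Ck, hij, hik, hjk, rfl⟩
  obtain ⟨hstar_rk, hstar_card⟩ := ThmN.eRk_le_and_ncard_eq_of_triangles M hC1 hx s hs
  rw [hscard] at hstar_card hstar_rk
  set St := ({x} ∪ (Ci ∪ Cj ∪ Ck) : Set α) with hSt
  have hSteq : ({x} ∪ ⋃ C ∈ s, C) = St := by
    ext z
    constructor
    · intro hz
      rcases hz with hz | hz
      · exact Or.inl hz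
      · obtain ⟨C, hC, hzC⟩ := Set.mem_iUnion₂.1 hz
        simp only [hsdef, Finset.mem_insert, Finset.mem_singleton] at hC
        rcases hC with rfl | rfl | rfl
        · exact Or.inr (Or.inl (Or.inl hzC))
        · exact Or.inr (Or.inl (Or.inr hzC))
        · exact Or.inr (Or.inr hzC)
    · intro hz
      rcases hz with hz | hz
      · exact Or.inl hz
      · refine Or.inr ?_
        rcases hz with (hz | hz) | hz
        · exact Set.mem_iUnion₂.2 ⟨Ci, by simp [hsdef], hz⟩
        · exact Set.mem_iUnion₂.2 ⟨Cj, by simp [hsdef], hz⟩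
        · exact Set.mem_iUnion₂.2 ⟨Ck, by simp [hsdef], hz⟩
  rw [hSteq] at hstar_card hstar_rk
  have hStU : St ⊆ ⋃₀ S := by
    intro z hz
    rcases hz with hz | hz
    · rw [Set.mem_singleton_iff.1 hz]; exact hxU'
    · rcases hz with (hz | hz) | hz
      · exact Set.mem_sUnion.2 ⟨Ci, ⟨hCi.1, hCi.2.1⟩, hz⟩
      · exact Set.mem_sUnion.2 ⟨Cj, ⟨hCj.1, hCj.2.1⟩, hz⟩
      · exact Set.mem_sUnion.2 ⟨Ck, ⟨hCk.1, hCk.2.1⟩, hz⟩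
  have hStE : St ⊆ M.E := hStU.trans hUE
  have hStfin : St.Finite := hUfin.subset hStU
  set Q := (⋃₀ S) \ St with hQ
  have hQfin : Q.Finite := hUfin.subset Set.sdiff_subset
  have hQSt : ∀ q ∈ Q, q ∉ St := fun q hq => hq.2
  have hQU : ∀ q ∈ Q, q ∈ ⋃₀ S := fun q hq => hq.1
  have hQE : ∀ q ∈ Q, q ∈ M.E := fun q hq => hUE hq.1
  -- every triangle lies in `U`; a triangle through a point off the star avoids `x`
  have hTU : ∀ T ∈ S, T ⊆ ⋃₀ S := fun T hT z hz => Set.mem_sUnion.2 ⟨T, hT, hz⟩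
  have hTx : ∀ {y : α}, y ∉ St → ∀ T ∈ ThmN.trianglesThrough M y, x ∉ T := by
    intro y hy T hT hxT
    apply hy
    rcases hmem3 T ⟨hT.1, hT.2.1, hxT⟩ with rfl | rfl | rfl
    · exact Or.inr (Or.inl (Or.inl hT.2.2))
    · exact Or.inr (Or.inl (Or.inr hT.2.2))
    · exact Or.inr (Or.inr hT.2.2)
  -- the eight triangles avoiding `x`
  set S₂ := {C | M.IsCircuit C ∧ C.ncard = 3 ∧ x ∉ C} with hS₂
  have hS₂fin : S₂.Finite := hSfin.subset (fun C hC => ⟨hC.1, hC.2.1⟩)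
  have hS₂S : ∀ T ∈ S₂, T ∈ S := fun T hT => ⟨hT.1, hT.2.1⟩
  have hS₂x : ∀ T ∈ S₂, x ∉ T := fun T hT => hT.2.2
  -- every triangle avoiding `x` has a point in `Q`
  have hQpt : ∀ T ∈ S₂, ∃ q ∈ T, q ∈ Q := by
    intro T hT
    obtain ⟨q, hqT, hqSt⟩ := exists_mem_notMem_star_of_notMem M hC1 hC2 hx hCi hCj hCk hij hik hjk
      (hS₂S T hT) (hS₂x T hT)
    exact ⟨q, hqT, hTU T (hS₂S T hT) hqT, hqSt⟩
  set S₂f : Finset (Set α) := hS₂fin.toFinset with hS₂fdef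
  have hmemS₂ : ∀ T, T ∈ S₂f ↔ T ∈ S₂ := fun T => Set.Finite.mem_toFinset hS₂fin
  have hS₂fcard : S₂f.card = 8 := by
    rw [hS₂fdef, ← Set.ncard_eq_toFinset_card _ hS₂fin, hS₂card]
  have hStcl' : St ⊆ M.closure St := M.subset_closure St hStE
  -- a point of `U` off `cl(St)`
  have hStcl : M.eRk (M.closure St) ≤ 4 := by
    rw [M.eRk_closure_eq]
    have h4 : ((1 + 3 : ℕ) : ℕ∞) = 4 := by norm_num
    rw [h4] at hstar_rk
    exact hstar_rk
  have hexO : ∃ q ∈ ⋃₀ S, q ∉ M.closure St := by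
    by_contra h
    push Not at h
    have hsub : ⋃₀ S ⊆ M.closure St := fun z hz => h z hz
    have h1 := M.eRk_mono hsub
    rw [hr5] at h1
    have h2 : (5 : ℕ∞) ≤ 4 := h1.trans hStcl
    have h3 : (5 : ℕ) ≤ 4 := by exact_mod_cast h2
    omega
  obtain ⟨q, hqU, hqcl⟩ := hexO
  have hqQ : q ∈ Q := ⟨hqU, fun h => hqcl (hStcl' h)⟩
  -- `U ∖ cl(St)` has at least `4` points, hence is `Q`
  set O := (⋃₀ S) \ M.closure St with hO
  have hOQ : O ⊆ Q := fun z hz => ⟨hz.1, fun h => hz.2 (hStcl' h)⟩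
  have hOfin : O.Finite := hUfin.subset Set.sdiff_subset
  have hO4 : 4 ≤ O.ncard := by
    have hTqfin : (ThmN.trianglesThrough M q).Finite := hSfin.subset (fun C hC => ⟨hC.1, hC.2.1⟩)
    set 𝒯 : Finset (Set α) := hTqfin.toFinset with h𝒯def
    have hmemq : ∀ T, T ∈ 𝒯 ↔ T ∈ ThmN.trianglesThrough M q := fun T => Set.Finite.mem_toFinset hTqfin
    have hcardq : 3 ≤ 𝒯.card := by
      rw [h𝒯def, ← Set.ncard_eq_toFinset_card _ hTqfin]
      exact hmin3 q hqU
    have hDfin : (O \ {q}).Finite := hOfin.subset Set.sdiff_subset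
    set K : Finset α := hDfin.toFinset with hKdef
    have hKcard : K.card = (O \ {q}).ncard := by
      rw [hKdef, ← Set.ncard_eq_toFinset_card _ hDfin]
    have hqD : q ∉ O \ {q} := fun h => h.2 (Set.mem_singleton q)
    have hK : ∀ T ∈ 𝒯, T ∩ (O \ {q}) ⊆ ↑K := by
      intro T _ z hz
      rw [hKdef, Set.Finite.coe_toFinset]
      exact hz.2
    by_contra hlt
    push Not at hlt
    have hqO : q ∈ O := ⟨hqU, hqcl⟩
    have hcardK : K.card < 𝒯.card := by
      rw [hKcard, Set.ncard_sdiff' (Set.singleton_subset_iff.2 hqO) hOfin, Set.ncard_singleton]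
      omega
    obtain ⟨T, hT𝒯, hTD⟩ :=
      exists_triangle_disjoint_of_card_lt M hC1 𝒯 (fun T hT => (hmemq T).1 hT) hqD K hK hcardK
    have hT : T ∈ ThmN.trianglesThrough M q := (hmemq T).1 hT𝒯
    obtain ⟨y, hyT, hyq, hycl⟩ := exists_mem_notMem_closure_of_notMem_closure M hqcl hT
    have hyO : y ∈ O \ {q} :=
      ⟨⟨hTU T ⟨hT.1, hT.2.1⟩ hyT, hycl⟩, fun h => hyq (Set.mem_singleton_iff.1 h)⟩
    have : y ∈ T ∩ (O \ {q}) := ⟨hyT, hyO⟩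
    rw [hTD] at this
    exact this
  have hOeq : O = Q := Set.eq_of_subset_of_ncard_le hOQ (by rw [hQ4]; exact hO4) hQfin
  have hQcl : ∀ z ∈ Q, z ∉ M.closure St := by
    intro z hz
    rw [← hOeq] at hz
    exact hz.2
  -- (B5) no triangle avoiding `x` has two star points
  have hB5 : ∀ T ∈ S₂, ∀ a ∈ T, ∀ b ∈ T, a ≠ b → a ∈ St → b ∈ St → False := by
    intro T hT a haT b hbT hab haSt hbSt
    obtain ⟨c, hcT, hcQ⟩ := hQpt T hT
    have hTcl : T ⊆ M.closure St := by
      refine (triangle_subset_closure_of_two_mem M (hS₂S T hT) haT hbT hab).trans ?_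
      refine M.closure_subset_closure_of_subset_closure ?_
      intro z hz
      rcases hz with rfl | hz
      · exact hStcl' haSt
      · rw [Set.mem_singleton_iff.1 hz]; exact hStcl' hbSt
    exact hQcl c hcQ (hTcl hcT)
  -- the count: six star points off `x`, each on `≥ 2` triangles avoiding `x`, disjoint families
  have hAfin : (St \ {x}).Finite := hStfin.subset Set.sdiff_subset
  set A : Finset α := hAfin.toFinset with hAdef
  have hmemA : ∀ a, a ∈ A ↔ a ∈ St \ {x} := fun a => Set.Finite.mem_toFinset hAfin
  have hxSt : x ∈ St := Or.inl rfl
  have hAcard : A.card = 6 := by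
    rw [hAdef, ← Set.ncard_eq_toFinset_card _ hAfin,
      Set.ncard_sdiff' (Set.singleton_subset_iff.2 hxSt) hStfin, hstar_card, Set.ncard_singleton]
  have hf2 : ∀ a ∈ A, 2 ≤ (S₂f.filter (fun T => a ∈ T)).card := by
    intro a ha
    have ha' := (hmemA a).1 ha
    have haSt : a ∈ St := ha'.1
    have hax : a ≠ x := fun h => ha'.2 (by rw [h]; exact Set.mem_singleton x)
    have haU : a ∈ ⋃₀ S := hStU haSt
    have hTafin : (ThmN.trianglesThrough M a).Finite := hSfin.subset (fun C hC => ⟨hC.1, hC.2.1⟩)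
    set Ta : Finset (Set α) := hTafin.toFinset with hTadef
    have hmema : ∀ T, T ∈ Ta ↔ T ∈ ThmN.trianglesThrough M a := fun T => Set.Finite.mem_toFinset hTafin
    have hTacard : 3 ≤ Ta.card := by
      rw [hTadef, ← Set.ncard_eq_toFinset_card _ hTafin]
      exact hmin3 a haU
    have hsplit := Finset.card_filter_add_card_filter_not (fun T => x ∈ T) (s := Ta)
    have hle1 : (Ta.filter (fun T => x ∈ T)).card ≤ 1 := by
      rw [Finset.card_le_one]
      intro T hT T' hT'
      rw [Finset.mem_filter, hmema] at hT hT'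
      by_contra hne
      have h := ThmN.inter_eq_singleton_of_mem_trianglesThrough M hC1 (x := x)
        ⟨hT.1.1, hT.1.2.1, hT.2⟩ ⟨hT'.1.1, hT'.1.2.1, hT'.2⟩ hne
      have : a ∈ T ∩ T' := ⟨hT.1.2.2, hT'.1.2.2⟩
      rw [h] at this
      exact hax (Set.mem_singleton_iff.1 this)
    have hsub : Ta.filter (fun T => ¬ x ∈ T) ⊆ S₂f.filter (fun T => a ∈ T) := by
      intro T hT
      rw [Finset.mem_filter, hmema] at hT
      rw [Finset.mem_filter, hmemS₂]
      exact ⟨⟨hT.1.1, hT.1.2.1, hT.2⟩, hT.1.2.2⟩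
    have := Finset.card_le_card hsub
    omega
  have hdisj : (↑A : Set α).PairwiseDisjoint (fun a => S₂f.filter (fun T => a ∈ T)) := by
    intro a ha b hb hab
    rw [Function.onFun, Finset.disjoint_left]
    intro T hTa hTb
    rw [Finset.mem_filter] at hTa hTb
    have haSt : a ∈ St := ((hmemA a).1 (Finset.mem_coe.1 ha)).1
    have hbSt : b ∈ St := ((hmemA b).1 (Finset.mem_coe.1 hb)).1
    exact hB5 T ((hmemS₂ T).1 hTa.1) a hTa.2 b hTb.2 hab haSt hbSt
  have hbiU : A.biUnion (fun a => S₂f.filter (fun T => a ∈ T)) ⊆ S₂f := by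
    intro T hT
    obtain ⟨a, -, hTa⟩ := Finset.mem_biUnion.1 hT
    exact (Finset.mem_filter.1 hTa).1
  have h12 : 12 ≤ (A.biUnion (fun a => S₂f.filter (fun T => a ∈ T))).card := by
    rw [Finset.card_biUnion hdisj]
    calc 12 = ∑ _a ∈ A, 2 := by rw [Finset.sum_const, hAcard, smul_eq_mul]
      _ ≤ ∑ a ∈ A, (S₂f.filter (fun T => a ∈ T)).card := Finset.sum_le_sum hf2
  have := Finset.card_le_card hbiU
  omega


end S1

end PercRepro
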